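import Summits.BirchSwinnertonDyer.Rank1Residual.F1Sign2.BlindOrderAtChi8
import Summits.BirchSwinnertonDyer.Rank1Residual.Supersingular.TamParityChi8Link
import Literature.NumberTheory.EllipticCurves.MazurTateElementOdd
import HarnessLib

/-!
# Cell `bsd-f1-sign2` (`p = 2`, non-CM) — analytic lens (seat `-an`) v3: the ± object at `2` on BOTH branches —
# odd-branch order law AN-6 `BlindOrderOddBranchAtTwo` (+ AN-6λ, AN-6P), the `a₂ = ±2` λ-law at `χ₈` AN-5T,
# and the conductor-8 TWIST-PACKET parity laws AN-8T / AN-8A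

HONEST FRAMING (typer seat `bsd-f1-sign2-ty`; HOME `run/shared/lean/pub/bsd-f1-sign2/`, CANDIDATES.md §2
rows AN-6/6λ/6P/5T/8T/8A posted by -an g2; ask D-ty-3 «port Sketch v3», STATUS 2026-08-27T16:00:00Z):
STATEMENTS ONLY — one helper predicate (`HasOrderAtZero`), six `@[conjecture] def`s (OPEN obligations of
ours: AN-6 / AN-6λ / AN-5T conjecture-grade; AN-6P / AN-8T expected theorems; AN-8A conjecture-grade as typed)
and two kernel-checked bookkeeping lemmas; nothing asserted, nothing booked, no named fact, PARTITION: none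
moved. Source: `HOME/MEMO-an-data/Sketch.lean` = Sketch_v3.lean sha16 b1ce2701aebb234a (planner
bsd-f1-sign2-an g2; `lean check` rc 0, 0 warnings, 0 sorries; it imports the tree files
`F1Sign2.BlindOrderAtChi8` (p542319), `Supersingular.TamParityChi8Link` and the typer's carrier
`Literature…MazurTateElementOdd` (p540558: `IsSprungPairOdd`)), re-filed VERBATIM (namespace
`…F1Sign2An` ↦ the cell's `…Rank1Residual.F1Sign2`; one unfolding-lemma docstring added). REFUTER PASS:
REF1-AUDIT-v1 §11 (g2 batch 5, 2026-08-27T16:21Z, file sha16 3753510c60dfbfcd): **6/6 SURVIVE**, BC7-LS CLEAN — AN-6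
conjecture (notes: `HasOrderAtZero 0 n` false ∀ n ⇒ the Prop silently asserts `L♯₋, L♭₋ ≠ 0`; the ∀ over ODD
pairs is non-vacuous only modulo an `exists_isSprungPairOdd_two` the tree lacks — asked of the typer; `a₂ = 0`
load-bearing; `r ≥ 2` corner untested), AN-6λ, AN-6P (support, theorem expected), AN-5T (pair exists + unique at
`a₂ = ±2`; parity already forced by tree theorems ⇒ content = the two lower bounds), AN-8T theorem-grade
(contrapositive of `χ₈_conductorNorm_eq_neg_one_of_goodSS_two_of_odd_tamagawaProduct` + Tate table), AN-8A
conjecture (= BSD₂-shadow on the packet; `d = 1` member = tree `one_le_padicValRat_ratPlusSymbol_zero_of_sign`).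
REF2-PLACEMENT-v5 §3: AN-6 value level PRINTED (Sprung arXiv:1211.1352 p.13 table row «p = 2, i ≠ 0»: the forced
zero of `L♯₋(0)` at `a₂ = 0`), ORDER law / double zero / `|r−1|` laws NOT printed; AN-6P IN-PRINT-ASSEMBLY
(functional equation on every branch, Sprung Cor 3.17); beyond-print theorem: no.

## The planner's sketch docstring (v3, verbatim)
# Cell `bsd-f1-sign2` (`p = 2`, non-CM) — analytic lens (seat `-an`), SKETCH v3 (GEN 2, 2026-08-27):
# the `±` object at `2` on BOTH branches — odd-branch order law (AN-6), odd-branch `λ`-parity (AN-6P),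
# the `a₂ = ±2` `λ`-law at `χ₈` (AN-5T), and the conductor-8 TWIST-PACKET parity laws (AN-8T / AN-8A)

HONEST FRAMING (planner seat `bsd-f1-sign2-an`, HOME `run/shared/lean/pub/bsd-f1-sign2/`, MEMO-an.md v1.3):
STATEMENTS ONLY — one helper predicate with body (`HasOrderAtZero`), six candidate `Prop`s WITHOUT PROOF
(`@[conjecture] def`, new names; nothing here re-words a killed decl: the killed -an decls are
`TwistPeriodAtTwo`, `SharpValueAtChi8Val`, `OddBranchValueAtChi4` (∃k∀W), AN-4, the AN-5 first drafts and
the overshoot law), plus two kernel-checked bookkeeping lemmas about the exponents. Nothing is asserted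
about any curve; no Literature fact; no route; nothing booked; PARTITION unchanged (leaf
`Rank1Residual.NonCMAtTwo`; bears on route `ByReductionTypeAtTwo` cruxes 19097 `SupersingularRankZeroAtTwo`
/ 19098 `AdditiveRankZeroAtTwo` — the twists `E^{(−1)}, E^{(±2)}` below ARE additive at `2`).

DICTIONARY (p = 2, `Γ = 1 + 4ℤ₂`, `T = γ − 1`, `Δ = (ℤ/8)^× = {1, χ₈, χ₋₄, χ₋₈}^∨`): the EVEN branch
(`mazurTateElement`, Sprung pair `IsSprungPair`) sees the characters `1` (at `T = 0`) and `χ₈` (at `T = −2`);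
the ODD branch (`mazurTateElementOdd`, p540558; pair `IsSprungPairOdd`) sees `χ₋₄` (at `T = 0`) and `χ₋₈`
(at `T = −2`) — `p = 2` is the only prime where the odd branch is self-dual (`ω² = 1`), so BOTH its
`ι`-fixed points are quadratic-twist central values: of `E^{(−1)}` (conductor `16N`) and `E^{(−2)}` (`64N`).

THE FOUR-CHARACTER ORDER TABLE (AN-5 ∪ AN-6; `r_d := r_an(E^{(d)})`, `a₂ = 0`):
  `1`:   `ord₀ L♯ = r₁` (honest)            `ord₀ L♭ = r₁` (honest)
  `χ₈`:  `ord₋₂ L♯ = r₂` (honest)           `ord₋₂ L♭ = |r₂ − 1|` (blind)          [AN-5, tree `BlindOrderAtChi8`]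
  `χ₋₄`: `ord₀ L♯₋ = |r₋₁ − 1| + 1` (forced, DOUBLE at `r₋₁ = 0`)   `ord₀ L♭₋ = r₋₁` (honest)   [AN-6]
  `χ₋₈`: `ord₋₂ L♯₋ = r₋₂` (honest)         `ord₋₂ L♭₋ = |r₋₂ − 1|` (blind)        [AN-6]
VALUE SHADOWS (AN-8A): at each of the three non-honest entries the parity/forced-zero bookkeeping
(`λ`-parity `(−1)^{λ♯} = χ₈(N)`, `(−1)^{λ♭} = −χ₈(N)` on BOTH branches; constant terms `L♯(0) = −4[0]⁺`,
`L♭(0) = [0]⁺` at `a₂ = 0`; the coupling `g(−2) ≡ g(0) − 2g′(0) (mod 4)`) forces the central value of the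
partner twist to be EVEN exactly when `N ≡ ±1 (mod 8)`; the `d = 1` member is the tree's T-PAR2
(`Supersingular.norm_ratPlusSymbol_zero_lt_one_of_sign`), the `d ∈ {−1, 2, −2}` members are AN-8A below.

CENSUS / BC5 WITNESSES (all scripts + outputs: HOME/MEMO-an-data/g2/, sha16 in MEMO-an.md v1.3 §9):
* AN-6 / AN-6λ / AN-6P: ENGINE D2 (j280798) exact `θ⁻_n` layers `n ≤ 7` × Cremona twist ranks, 130 `a₂ = 0`
  curves (`N` odd `< 2000`): `λ♭₋ − (r₋₁ + |r₋₂−1|)` and `λ♯₋ − (|r₋₁−1| + 1 + r₋₂)` are `≥ 0` and EVEN on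
  130/130 (cells `(r₋₁,r₋₂)` = (0,0) 6, (0,1) 88, (0,2) 1, (1,0) 29, (1,2) 6); order-level certificate:
  `[T⁰]θ⁻_n = 0` (odd `n`) on 130/130, `[T¹]L♯₋ ≡ 0 (mod 8)` on 111/111 `r₋₁ = 0` rows (double zero) and
  odd on exactly the 25 `λ♯₋ = 1` rows of `r₋₁ = 1`; parity `(−1)^{λ♯₋} = χ₈(N)`, `(−1)^{λ♭₋} = −χ₈(N)` on
  130/130 + 130/130. UNTESTED: `r₋₁ ≥ 2` (no D2 row), `a₂ = ±2` odd branch.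
* AN-5T (`a₂ = ±2`): SF2-ALL certified `λ` (μ = 0 certified) × Cremona twist ranks, 876 rows
  (421 `a₂ = 2`, 455 `a₂ = −2`), all `(r, r₂)` with `r ≤ 2, r₂ ≤ 2`: 0 violations, every excess even.
* AN-8T: full Cremona `N < 5·10⁵`: `E` good supersingular at `2`, `N_E ≡ ±1 (mod 8)` ⇒ `Tam(E^{(d)})` even
  for `d = −1` on 7 038/7 038 (`N ≤ 31 250`), `d = 2` on 1 703/1 703, `d = −2` on 1 703/1 703 (`N ≤ 7 812`);
  control `N ≡ ±3`: odd on 4 705/9 733, 1 477/2 579, 1 477/2 579.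
* AN-8A: same range, rank-0 twists: `v₂(L(E^{(d)},1)/Ω_{E^{(d)}}) ≥ 1` (Cremona normalisation, `= Ш·Tam/t²`)
  on 3 213/3 213 (`d = −1`), 521/521 (`d = 2`), 626/626 (`d = −2`), minimum `1` attained in every
  `a₂ ∈ {0, ±2}` class; control `N ≡ ±3`: `v₂ = 0` on 2 041/4 761, 575/1 064, 549/1 007.
-/

set_option autoImplicit false

noncomputable section

open scoped Classical MatrixGroups ModularForm

open CongruenceSubgroup Polynomial WeierstrassCurve Literature.NumberTheory.EllipticCurves
  Literature.NumberTheory.EllipticCurves.ModularForms Literature.NumberTheory.EllipticCurves.Sprung2017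
  Literature.NumberTheory.EllipticCurves.Rank1Residual Summit.BirchSwinnertonDyer.Rank1Residual.X1.MuLambda

namespace Summit.BirchSwinnertonDyer.Rank1Residual.F1Sign2

/-! ## §0 Helper predicate: order of vanishing at the trivial character `T = 0` -/

/-- **Order of vanishing `n` of `L ∈ Λ = ℤ₂⟦T⟧` at `T = 0`**: `T^n ∣ L` and `T^{n+1} ∤ L`
(companion of the tree's `HasOrderAtNegTwo`). Helper predicate; nothing asserted. [folklore] -/
def HasOrderAtZero (L : IwasawaAlgebra 2) (n : ℕ) : Prop :=
  (PowerSeries.X : IwasawaAlgebra 2) ^ n ∣ L ∧ ¬ (PowerSeries.X : IwasawaAlgebra 2) ^ (n + 1) ∣ L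

/-- Unfolding lemma for `HasOrderAtZero`. [folklore] -/
theorem hasOrderAtZero_iff (L : IwasawaAlgebra 2) (n : ℕ) :
    HasOrderAtZero L n ↔
      (PowerSeries.X : IwasawaAlgebra 2) ^ n ∣ L ∧ ¬ (PowerSeries.X : IwasawaAlgebra 2) ^ (n + 1) ∣ L :=
  Iff.rfl

/-! ## §1 AN-6: the odd-branch order law at the two `ι`-fixed points -/

/-- **CANDIDATE AN-6 `BlindOrderOddBranchAtTwo` (conjecture-grade, new in -an v3).** For `W` good
supersingular at `2` with `a₂ = 0`, newform `f`, EVERY odd-branch Sprung pair `(L♯₋, L♭₋)` of `f` at `2`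
(`IsSprungPairOdd`, p540558), `W₋₁` a model of `W ⊗ χ₋₄` and `W₋₂` a model of `W ⊗ χ₋₈`
(`r₋₁ := r_an(W₋₁)`, `r₋₂ := r_an(W₋₂)`): at `T = 0` (`χ₋₄`) `ord₀ L♭₋ = r₋₁` (honest) and
`ord₀ L♯₋ = |r₋₁ − 1| + 1` (a FORCED zero — `θ⁻₁(𝟙) = a₂·θ⁻₀(𝟙)` by the Manin–Hecke relation at the
bottom of the `χ₋₄`-tower and `θ⁻_{n+1}(𝟙) = a₂θ⁻_n(𝟙) − 2θ⁻_{n−1}(𝟙)`, so `θ⁻_n(0) = 0` for every odd `n` when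
`a₂ = 0`, whence `L♯₋(0) = 0`; the zero is DOUBLE when `r₋₁ = 0`); at `T = −2` (`χ₋₈`) `ord₋₂ L♯₋ = r₋₂` (honest) and `ord₋₂ L♭₋ = |r₋₂ − 1|` (blind; mirror of AN-5).
Witness: `λ`-shadow 130/130 + order-level certificate (file docstring). Why it might fail: `r₋₁ ≥ 2` is
unobserved (the `|r₋₁ − 1| + 1` branch for `r₋₁ = 2, 3` predicts orders `2, 3`); the odd-branch pair is only
determined modulo the kernel of `(u_n, v_n)_n`, as on the even branch. [folklore] -/
@[conjecture] def BlindOrderOddBranchAtTwo : Prop :=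
  ∀ {N : ℕ} [NeZero N] (f : CuspForm (Gamma0 N) 2) (W : WeierstrassCurve ℚ) [W.IsElliptic] [W.IsGloballyMinimal]
    (Wm1 : WeierstrassCurve ℚ) [Wm1.IsElliptic] (Wm2 : WeierstrassCurve ℚ) [Wm2.IsElliptic]
    (Lsharp Lflat : IwasawaAlgebra 2),
    IsNewformOf W f → GoodSS W 2 → W.frobeniusTrace 2 = 0 →
    IsSprungPairOdd f 2 (W.frobeniusTrace 2) Lsharp Lflat →
    (∃ C : WeierstrassCurve.VariableChange ℚ, C • W.quadraticTwist (-1) = Wm1) →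
    (∃ C : WeierstrassCurve.VariableChange ℚ, C • W.quadraticTwist (-2) = Wm2) →
    (HasOrderAtZero Lflat Wm1.analyticRank ∧
      HasOrderAtZero Lsharp ((((Wm1.analyticRank : ℤ) - 1).natAbs) + 1)) ∧
    (HasOrderAtNegTwo Lsharp Wm2.analyticRank ∧
      HasOrderAtNegTwo Lflat (((Wm2.analyticRank : ℤ) - 1).natAbs))

/-- **AN-6λ `SignedLambdaBoundsOddBranchAtTwo` (the TESTED shadow of AN-6; conjecture-grade, refutable row by
row from `μ = 0` / `λ` readings of `θ⁻_n`):** `λ(L♭₋) = r₋₁ + |r₋₂ − 1| + 2k′` and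
`λ(L♯₋) = (|r₋₁ − 1| + 1) + r₋₂ + 2k`. Census: 130/130 `a₂ = 0` rows, 0 violations, 0 odd excess
(equality: ♭ 83/88 on (0,1), ♯ 25/29 on (1,0)). `L ≠ 0`, `μ = 0` guards as in `SignedLambdaBoundsAtChi8`.
[folklore] -/
@[conjecture] def SignedLambdaBoundsOddBranchAtTwo : Prop :=
  ∀ {N : ℕ} [NeZero N] (f : CuspForm (Gamma0 N) 2) (W : WeierstrassCurve ℚ) [W.IsElliptic] [W.IsGloballyMinimal]
    (Wm1 : WeierstrassCurve ℚ) [Wm1.IsElliptic] (Wm2 : WeierstrassCurve ℚ) [Wm2.IsElliptic]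
    (Lsharp Lflat : IwasawaAlgebra 2),
    IsNewformOf W f → GoodSS W 2 → W.frobeniusTrace 2 = 0 →
    IsSprungPairOdd f 2 (W.frobeniusTrace 2) Lsharp Lflat →
    (∃ C : WeierstrassCurve.VariableChange ℚ, C • W.quadraticTwist (-1) = Wm1) →
    (∃ C : WeierstrassCurve.VariableChange ℚ, C • W.quadraticTwist (-2) = Wm2) →
    Lsharp ≠ 0 → Lflat ≠ 0 → mu Lsharp = 0 → mu Lflat = 0 →
    (∃ k : ℕ, lam Lflat = Wm1.analyticRank + (((Wm2.analyticRank : ℤ) - 1).natAbs) + 2 * k) ∧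
      (∃ k : ℕ, lam Lsharp = ((((Wm1.analyticRank : ℤ) - 1).natAbs) + 1) + Wm2.analyticRank + 2 * k)

/-- **AN-6P `OddBranchLambdaParityAtTwo` (expected THEOREM — the odd-branch twin of the tree's
`Supersingular.neg_one_pow_lam_sharp_two` / `neg_one_pow_lam_flat_two`, provable by the same argument once the
functional equation of the ODD Mazur–Tate elements at `2` is typed; statement only here):**
for every odd-branch Sprung pair of a good-supersingular-at-`2` newform, `(−1)^{λ(L♯₋)} = χ₈(N)` and
`(−1)^{λ(L♭₋)} = −χ₈(N)` — the SAME signs as on the even branch (because `w(E^{(−1)})·w(E^{(−2)}) =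
χ₋₄(−N)χ₋₈(−N) = χ₈(N)`). Census: 130/130 and 130/130 (`a₂ = 0`; `a₂ = ±2` untested). It is the parity
input of the `d = −1, −2` members of AN-8A. [folklore] -/
@[conjecture] def OddBranchLambdaParityAtTwo : Prop :=
  ∀ {N : ℕ} [NeZero N] (f : CuspForm (Gamma0 N) 2) (W : WeierstrassCurve ℚ) [W.IsElliptic] [W.IsGloballyMinimal]
    (Lsharp Lflat : IwasawaAlgebra 2),
    IsNewformOf W f → GoodSS W 2 →
    IsSprungPairOdd f 2 (W.frobeniusTrace 2) Lsharp Lflat →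
    (Lsharp ≠ 0 → mu Lsharp = 0 → (-1 : ℤ) ^ lam Lsharp = ZMod.χ₈ (N : ZMod 8)) ∧
      (Lflat ≠ 0 → mu Lflat = 0 → (-1 : ℤ) ^ lam Lflat = -ZMod.χ₈ (N : ZMod 8))

/-! ## §2 AN-5T: the `λ`-law at `χ₈` for trace `a₂ = ±2` -/

/-- **AN-5T `SignedLambdaBoundsAtChi8TraceTwo` (conjecture-grade; extends the tree's `SignedLambdaBoundsAtChi8`
from `a₂ = 0` to `a₂ = ±2`, where the ORDER mechanism differs — by the tree's flat law
`BlindPointFlatTwo.flatLaw_evalAt_neg_two` (`5·L♭(−2) = ∓2·L♯(−2)` under `w·χ₈(N) = +1`) the ♭-function has NO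
forced zero at `r₂ = 0` but an extra factor `2`, so the `λ`-SHADOW is the same):** `λ♯ = r + r₂ + 2k`,
`λ♭ = r + |r₂ − 1| + 2k′`. Census: 876/876 SF2-ALL rows with certified `μ = 0` (421 `a₂ = 2` + 455
`a₂ = −2`), 0 violations, 0 odd excess; minima `(λ♯, λ♭)` per `(r, r₂)`: (0,0)(2,1) (0,1)(1,0) (0,2)(2,1)
(1,0)(1,2) (1,1)(2,1) (1,2)(3,2) (2,0)(2,3) (2,1)(3,2) (2,2)(4,3). [folklore] -/
@[conjecture] def SignedLambdaBoundsAtChi8TraceTwo : Prop :=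
  ∀ {N : ℕ} [NeZero N] (f : CuspForm (Gamma0 N) 2) (W : WeierstrassCurve ℚ) [W.IsElliptic] [W.IsGloballyMinimal]
    (W₂ : WeierstrassCurve ℚ) [W₂.IsElliptic] (Lsharp Lflat : IwasawaAlgebra 2),
    IsNewformOf W f → GoodSS W 2 → (W.frobeniusTrace 2 = 2 ∨ W.frobeniusTrace 2 = -2) →
    IsSprungPair f 2 (W.frobeniusTrace 2) Lsharp Lflat →
    (∃ C : WeierstrassCurve.VariableChange ℚ, C • W.quadraticTwist 2 = W₂) →
    Lsharp ≠ 0 → Lflat ≠ 0 → mu Lsharp = 0 → mu Lflat = 0 →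
    (∃ k : ℕ, lam Lsharp = W.analyticRank + W₂.analyticRank + 2 * k) ∧
      (∃ k : ℕ, lam Lflat = W.analyticRank + (((W₂.analyticRank : ℤ) - 1).natAbs) + 2 * k)

/-! ## §3 AN-8: the conductor-8 twist packet `{E, E^{(−1)}, E^{(2)}, E^{(−2)}}` — parity laws -/

/-- **AN-8T `TwistPacketTamagawaEvenAtTwo` (expected THEOREM, elementary; new as a statement):** for `W`
good supersingular at `2` with `χ₈(N_W) = +1` (`N_W ≡ ±1 (mod 8)`) and `W'` a globally minimal model of the
quadratic twist `W ⊗ χ_d`, `d ∈ {−1, 2, −2}` (ADDITIVE at `2`, conductor `16N` resp. `64N` — the domain of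
crux 19098): `Tam(W')` is even. Mechanism: the tree's
`Supersingular.χ₈_conductorNorm_eq_neg_one_of_goodSS_two_of_odd_tamagawaProduct` gives `Tam(W)` even, and the
parity of `c_ℓ` at every ODD prime `ℓ` is invariant under an unramified quadratic twist (Tate's algorithm:
`I_n`: `c` even iff `n` even in both split/non-split cases; `I_n^*`, `III`, `III*`: always even; `IV`, `IV*`:
`{1,3}`; `I_0^*`, `II`, `II*`: `−1` acts trivially on `Φ`), so an even `c_ℓ(W)` survives in `W'` whatever
`c₂(W') ∈ {1,2,3,4}` is. Census: 10 444/10 444 (7 038 + 1 703 + 1 703); control `N ≡ ±3`: odd on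
7 659/14 891. [folklore] -/
@[conjecture] def TwistPacketTamagawaEvenAtTwo : Prop :=
  ∀ (W : WeierstrassCurve ℚ) [W.IsElliptic] [W.IsGloballyMinimal]
    (W' : WeierstrassCurve ℚ) [W'.IsElliptic] [W'.IsGloballyMinimal] (d : ℤ),
    GoodSS W 2 → ZMod.χ₈ (W.conductorNorm ℤ : ZMod 8) = 1 → (d = -1 ∨ d = 2 ∨ d = -2) →
    (∃ C : WeierstrassCurve.VariableChange ℚ, C • W.quadraticTwist d = W') →
    2 ∣ W'.tamagawaProduct

/-- **AN-8A `TwistPacketLValueEvenAtTwo` (conjecture-grade AS TYPED; the `d = 2` member is expected provable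
from tree theorems — `λ♯`-parity `neg_one_pow_lam_sharp_two`, the constant terms `L♯(0) ∈ 4[0]⁺ℤ₂` (`a₂ = 0`) /
T-PAR2 (`a₂ = ±2`), the coupling `L♯(−2) ≡ L♯(0) − 2·[T¹]L♯ (mod 4)` and `coe_evalAt_sharp_neg_two_eq`
(`L♯(−2) = −2([1/8]⁺ − [5/8]⁺)`) — up to the modular-symbol/period bridge `[0]⁺_{f ⊗ χ₈} ↔ [1/8]⁺_f − [5/8]⁺_f`;
the `d = −1, −2` members need the odd-branch parity AN-6P):** for `W` good supersingular at `2` with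
`χ₈(N_W) = +1`, `W'` a model of `W ⊗ χ_d` (`d ∈ {−1, 2, −2}`) with newform `f'` and `L(W',1) ≠ 0`:
`v₂([0]⁺_{f'}) ≥ 1` — the analytic BSD₂-shadow matching AN-8T (`W'(ℚ)[2] = 0`). Census (Cremona
normalisation `L/Ω = Ш·Tam/t²`, which is `≤ v₂([0]⁺_{f'})`): 4 360/4 360 (3 213 + 521 + 626), minimum `1`
attained; control `N ≡ ±3`: `v₂ = 0` on 3 165/6 832. The `d = 1` member is the tree's T-PAR2. [folklore] -/
@[conjecture] def TwistPacketLValueEvenAtTwo : Prop :=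
  ∀ {N' : ℕ} [NeZero N'] (f' : CuspForm (Gamma0 N') 2)
    (W : WeierstrassCurve ℚ) [W.IsElliptic] [W.IsGloballyMinimal]
    (W' : WeierstrassCurve ℚ) [W'.IsElliptic] (d : ℤ),
    GoodSS W 2 → ZMod.χ₈ (W.conductorNorm ℤ : ZMod 8) = 1 → (d = -1 ∨ d = 2 ∨ d = -2) →
    (∃ C : WeierstrassCurve.VariableChange ℚ, C • W.quadraticTwist d = W') →
    IsNewformOf W' f' → W'.entireLFunction 1 ≠ 0 →
    1 ≤ padicValRat 2 (ratPlusSymbol f' 0)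

/-! ## §4 Kernel-checked bookkeeping of the exponents -/

/-- AN-6's forced `♯₋`-exponent `|r₋₁ − 1| + 1` takes the values `2, 1, 2, 3` at `r₋₁ = 0, 1, 2, 3`: a DOUBLE
zero at `r₋₁ = 0` (certificate: `[T¹]L♯₋ ≡ 0 (mod 8)` on 111/111 rows), a simple one at `r₋₁ = 1`. [folklore] -/
theorem oddSharpExponent_values :
    ((((0 : ℕ) : ℤ) - 1).natAbs + 1 = 2) ∧ ((((1 : ℕ) : ℤ) - 1).natAbs + 1 = 1) ∧
      ((((2 : ℕ) : ℤ) - 1).natAbs + 1 = 2) ∧ ((((3 : ℕ) : ℤ) - 1).natAbs + 1 = 3) := by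
  decide

/-- Parity bookkeeping behind AN-6P/AN-6λ: the forced `♯₋`-exponent has the parity of `r₋₁`, so
`λ(L♯₋) ≡ r₋₁ + r₋₂` and `λ(L♭₋) ≡ r₋₁ + r₋₂ + 1 (mod 2)` under AN-6λ — consistent with
`(−1)^{λ♯₋} = w(E^{(−1)})·w(E^{(−2)}) = χ₈(N)`. [folklore] -/
theorem oddSharpExponent_mod_two (r : ℕ) : ((((r : ℤ) - 1).natAbs + 1) % 2) = r % 2 := by
  rcases r with _ | r
  · simp
  · have h : (((r + 1 : ℕ) : ℤ) - 1).natAbs = r := by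
      simp
    omega

end Summit.BirchSwinnertonDyer.Rank1Residual.F1Sign2

end
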